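import Mathlib
import HarnessLib

/-!
# SymmetryDial — the two orbits of `AGL_d(𝔽₂)` on matrix positions, and budget-`0` counting

Support file for `Theorems/SymmetryDialAffineTransferZero.lean` (the `k = 0` rung of the transfer
statement `AffineLogicTransfer` of `Theorems/SymmetryDialAffineCFISplit.lean`).

* `AGL_d(𝔽₂)` (the closure group of the route `SymmetryDial`) contains all translations
  (`addRight_mem`) and the transvections `x ↦ x + ⟨ξ,x⟩·w` with `⟨ξ,w⟩ = 0` (`tv_mem`); hence it is
  `2`-transitive on `𝔽₂^d` (`exists_map_pair`), so its diagonal action on `𝔽₂^d × 𝔽₂^d` has exactly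
  the two orbits DIAGONAL / OFF-DIAGONAL (`count_eq_of_diag`, `count_eq_of_offDiag`).
* Consequently a list of matrix positions whose multiplicities are `AGL_d`-invariant counts, against
  any `0/1`-matrix `f`, the affine combination `c₁ · dg f + c₂ · od f` of the number `dg f` of diagonal
  ones and the number `od f` of off-diagonal ones (`countP_eq_lin`, `countP_inputs_eq`).

Elementary linear algebra over `𝔽₂` written out by hand (no `Module` instances are put on
`Fin d → Fin 2`; the closure group is generated by the maps preserving `x + y + z`).
-/

set_option linter.dupNamespace false

namespace Summit.ValiantsHypothesis.ValiantsHypothesis.Theorems.SymmetryDialAffineOrbits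

open Finset

/-- `𝔽₂^d` as functions. -/
abbrev V (d : ℕ) : Type := Fin d → Fin 2

/-- `AGL_d(𝔽₂)` presented as in the route: the closure of the maps preserving `x + y + z`. -/
abbrev AGL (d : ℕ) : Subgroup (Equiv.Perm (V d)) :=
  Subgroup.closure {σ : Equiv.Perm (V d) | ∀ x y z : V d, σ (x + y + z) = σ x + σ y + σ z}

/-- The diagonal action on positions. -/
def diag {d : ℕ} (σ : Equiv.Perm (V d)) (p : V d × V d) : V d × V d := (σ p.1, σ p.2)

variable {d : ℕ}

/-! ### Characteristic two -/

/-- `v + v = 0`. -/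
theorem add_self (v : V d) : v + v = 0 := by
  funext i
  have h : ∀ a : Fin 2, a + a = 0 := by decide
  exact h (v i)

/-- `v + w + w = v`. -/
theorem add_add_cancel (v w : V d) : v + w + w = v := by
  rw [add_assoc, add_self, add_zero]

/-- `x + y = 0 → x = y`. -/
theorem eq_of_add_eq_zero {x y : V d} (h : x + y = 0) : x = y := by
  have := congrArg (· + y) h
  simpa [add_add_cancel] using this

/-- Translations lie in `AGL_d`. -/
theorem addRight_mem (t : V d) : Equiv.addRight t ∈ AGL d := by
  refine Subgroup.subset_closure fun x y z => ?_
  show x + y + z + t = x + t + (y + t) + (z + t)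
  rw [show x + t + (y + t) + (z + t) = x + y + z + t + (t + t) by abel, add_self, add_zero]

/-! ### The standard pairing and transvections -/

/-- `⟨ξ, v⟩ = ∑ ξ_i v_i`. -/
def pair (ξ v : V d) : Fin 2 := ∑ i, ξ i * v i

/-- Additivity in the second argument. -/
theorem pair_add (ξ v w : V d) : pair ξ (v + w) = pair ξ v + pair ξ w := by
  simp only [pair, Pi.add_apply, mul_add, sum_add_distrib]

/-- Additivity in the first argument. -/
theorem add_pair (ξ ξ' v : V d) : pair (ξ + ξ') v = pair ξ v + pair ξ' v := by
  simp only [pair, Pi.add_apply, add_mul, sum_add_distrib]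

/-- `⟨ξ, 0⟩ = 0`. -/
theorem pair_zero (ξ : V d) : pair ξ 0 = 0 := by simp [pair]

/-- Scalar multiple `c · w`. -/
def smul (c : Fin 2) (w : V d) : V d := fun i => c * w i

/-- `a·w + b·w = (a+b)·w`. -/
theorem smul_add_smul (a b : Fin 2) (w : V d) : smul a w + smul b w = smul (a + b) w := by
  funext i; simp [smul, add_mul]

/-- `0·w = 0`. -/
theorem zero_smul' (w : V d) : smul 0 w = 0 := by funext i; simp [smul]

/-- `1·w = w`. -/
theorem one_smul' (w : V d) : smul 1 w = w := by funext i; simp [smul]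

/-- `⟨ξ, c·w⟩ = c ⟨ξ, w⟩`. -/
theorem pair_smul (ξ : V d) (c : Fin 2) (w : V d) : pair ξ (smul c w) = c * pair ξ w := by
  unfold pair smul
  rw [mul_sum]
  exact sum_congr rfl fun i _ => mul_left_comm _ _ _

/-- The transvection `x ↦ x + ⟨ξ,x⟩·w`. -/
def tvFun (ξ w : V d) (x : V d) : V d := x + smul (pair ξ x) w

/-- With `⟨ξ,w⟩ = 0` the transvection is an involution. -/
theorem tvFun_invol (ξ w : V d) (hw : pair ξ w = 0) (x : V d) : tvFun ξ w (tvFun ξ w x) = x := by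
  have hc : pair ξ (x + smul (pair ξ x) w) = pair ξ x := by
    rw [pair_add, pair_smul, hw, mul_zero, add_zero]
  unfold tvFun
  rw [hc, add_add_cancel]

/-- The transvection as a permutation. -/
def tv (ξ w : V d) (hw : pair ξ w = 0) : Equiv.Perm (V d) :=
  ⟨tvFun ξ w, tvFun ξ w, tvFun_invol ξ w hw, tvFun_invol ξ w hw⟩

/-- Transvections are additive, hence lie in `AGL_d`. -/
theorem tv_mem (ξ w : V d) (hw : pair ξ w = 0) : tv ξ w hw ∈ AGL d := by
  refine Subgroup.subset_closure fun x y z => ?_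
  show tvFun ξ w (x + y + z) = tvFun ξ w x + tvFun ξ w y + tvFun ξ w z
  simp only [tvFun, pair_add, ← smul_add_smul]
  abel

/-- `tv 0 = 0`. -/
theorem tv_zero (ξ w : V d) (hw : pair ξ w = 0) : tv ξ w hw 0 = 0 := by
  show tvFun ξ w 0 = 0
  rw [tvFun, pair_zero, zero_smul', add_zero]

/-- `tv u = u + w` when `⟨ξ,u⟩ = 1`. -/
theorem tv_apply_of (ξ w : V d) (hw : pair ξ w = 0) {u : V d} (hu : pair ξ u = 1) :
    tv ξ w hw u = u + w := by
  show tvFun ξ w u = u + w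
  rw [tvFun, hu, one_smul']

/-- The coordinate vector `e_i`. -/
def e (i : Fin d) : V d := fun j => if j = i then 1 else 0

/-- `⟨e_i, v⟩ = v_i`. -/
theorem pair_e (i : Fin d) (v : V d) : pair (e i) v = v i := by
  simp [pair, e, ite_mul]

/-- A nonzero vector of `𝔽₂^d` has a coordinate equal to `1`. -/
theorem exists_coord_one {w : V d} (hw : w ≠ 0) : ∃ i, w i = 1 := by
  by_contra h
  push Not at h
  apply hw
  funext i
  have h2 : ∀ a : Fin 2, a ≠ 1 → a = 0 := by decide
  exact h2 _ (h i)

/-- Two nonzero vectors admit a common functional taking the value `1` on both. -/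
theorem exists_dual {u v : V d} (hu : u ≠ 0) (hv : v ≠ 0) :
    ∃ ξ : V d, pair ξ u = 1 ∧ pair ξ v = 1 := by
  have h2 : ∀ a : Fin 2, a ≠ 1 → a = 0 := by decide
  obtain ⟨i, hi⟩ := exists_coord_one hu
  by_cases hvi : v i = 1
  · exact ⟨e i, by rw [pair_e, hi], by rw [pair_e, hvi]⟩
  obtain ⟨j, hj⟩ := exists_coord_one hv
  by_cases huj : u j = 1
  · exact ⟨e j, by rw [pair_e, huj], by rw [pair_e, hj]⟩
  refine ⟨e i + e j, ?_, ?_⟩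
  · rw [add_pair, pair_e, pair_e, hi, h2 _ huj]; decide
  · rw [add_pair, pair_e, pair_e, hj, h2 _ hvi]; decide

/-! ### Two-transitivity of `AGL_d` -/

/-- `GL_d ≤ AGL_d` is transitive on nonzero vectors (by a transvection or the identity). -/
theorem exists_linear_map {u v : V d} (hu : u ≠ 0) (hv : v ≠ 0) :
    ∃ L ∈ AGL d, L 0 = 0 ∧ L u = v := by
  by_cases huv : u = v
  · exact ⟨1, one_mem _, rfl, by rw [huv]; rfl⟩
  obtain ⟨ξ, hξu, hξv⟩ := exists_dual hu hv
  have hw : pair ξ (u + v) = 0 := by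
    rw [pair_add, hξu, hξv]; decide
  refine ⟨tv ξ (u + v) hw, tv_mem _ _ _, tv_zero _ _ _, ?_⟩
  rw [tv_apply_of _ _ _ hξu, ← add_assoc, add_self, zero_add]

/-- **`AGL_d` is `2`-transitive on `𝔽₂^d`.** -/
theorem exists_map_pair {x y x' y' : V d} (h : x ≠ y) (h' : x' ≠ y') :
    ∃ σ ∈ AGL d, σ x = x' ∧ σ y = y' := by
  have hu : x + y ≠ 0 := fun h0 => h (eq_of_add_eq_zero h0)
  have hv : x' + y' ≠ 0 := fun h0 => h' (eq_of_add_eq_zero h0)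
  obtain ⟨L, hL, hL0, hLu⟩ := exists_linear_map hu hv
  refine ⟨Equiv.addRight x' * (L * Equiv.addRight x),
    mul_mem (addRight_mem x') (mul_mem hL (addRight_mem x)), ?_, ?_⟩
  · show L (x + x) + x' = x'
    rw [add_self, hL0, zero_add]
  · show L (y + x) + x' = y'
    rw [add_comm y x, hLu, add_comm x' y', add_add_cancel]

/-- `AGL_d` is transitive on `𝔽₂^d` (translations). -/
theorem exists_map_point (x x' : V d) : ∃ σ ∈ AGL d, σ x = x' :=
  ⟨Equiv.addRight (x + x'), addRight_mem _, by
    show x + (x + x') = x'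
    rw [← add_assoc, add_self, zero_add]⟩

/-! ### Invariant multiplicities are constant on the two orbits -/

/-- `diag σ` is injective. -/
theorem diag_injective (σ : Equiv.Perm (V d)) : Function.Injective (diag σ) := by
  intro p q h
  simp only [diag, Prod.mk.injEq] at h
  exact Prod.ext (σ.injective h.1) (σ.injective h.2)

/-- Invariant multiplicities agree on any two diagonal positions. -/
theorem count_eq_of_diag (L : List (V d × V d))
    (hinv : ∀ σ ∈ AGL d, ∀ p, L.count (diag σ p) = L.count p) (x y : V d) :
    L.count (x, x) = L.count (y, y) := by
  obtain ⟨σ, hσ, hσx⟩ := exists_map_point x y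
  rw [← hinv σ hσ (x, x), diag, hσx]

/-- Invariant multiplicities agree on any two off-diagonal positions. -/
theorem count_eq_of_offDiag (L : List (V d × V d))
    (hinv : ∀ σ ∈ AGL d, ∀ p, L.count (diag σ p) = L.count p) {x y x' y' : V d} (h : x ≠ y)
    (h' : x' ≠ y') : L.count (x, y) = L.count (x', y') := by
  obtain ⟨σ, hσ, hσx, hσy⟩ := exists_map_pair h h'
  rw [← hinv σ hσ (x, y), diag, hσx, hσy]

/-! ### Counting against a `0/1`-matrix -/

/-- Number of diagonal ones of `f`. -/
def dg (f : V d × V d → Bool) : ℕ := (univ.filter fun x : V d => f (x, x) = true).card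

/-- Number of off-diagonal ones of `f`, row by row. -/
def od (f : V d × V d → Bool) : ℕ := ∑ x : V d, ((univ.erase x).filter fun y : V d => f (x, y) = true).card

/-- A `countP` over a list is the multiplicity-weighted sum over the type. -/
theorem countP_eq_sum_count {α : Type} [Fintype α] [DecidableEq α] [BEq α] [LawfulBEq α]
    (p : α → Bool) :
    ∀ L : List α, L.countP p = ∑ a, if p a = true then L.count a else 0
  | [] => by simp
  | b :: L => by
    rw [List.countP_cons, countP_eq_sum_count p L]
    have h2 : ∀ a, (if p a = true then (b :: L).count a else 0) =
        (if p a = true then L.count a else 0) + (if a = b then (if p a = true then 1 else 0) else 0) := by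
      intro a
      rw [List.count_cons]
      by_cases hp : p a = true <;> by_cases hab : a = b
      · subst hab; simp [hp]
      · simp [hp, Ne.symm hab, hab]
      · subst hab; simp [hp]
      · simp [hp, hab]
    rw [sum_congr rfl fun a _ => h2 a, sum_add_distrib, sum_ite_eq' univ b, if_pos (mem_univ b)]

/-- The reference off-diagonal multiplicity (or `0` when `d = 0` and there is none). -/
noncomputable def offRef (L : List (V d × V d)) : ℕ := by
  classical
  exact if h : ∃ p : V d × V d, p.1 ≠ p.2 then L.count h.choose else 0

/-- An off-diagonal position has the reference multiplicity. -/
theorem count_offDiag_eq_offRef (L : List (V d × V d))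
    (hinv : ∀ σ ∈ AGL d, ∀ p, L.count (diag σ p) = L.count p) {x y : V d} (h : x ≠ y) :
    L.count (x, y) = offRef L := by
  classical
  have hex : ∃ p : V d × V d, p.1 ≠ p.2 := ⟨(x, y), h⟩
  unfold offRef
  rw [dif_pos hex]
  have hc := hex.choose_spec
  rw [count_eq_of_offDiag L hinv h hc]

/-- **Budget-`0` counting**: an `AGL_d`-invariant list of positions counts, against `f`, the affine
combination `c₁ · dg f + c₂ · od f`. -/
theorem countP_eq_lin (L : List (V d × V d))
    (hinv : ∀ σ ∈ AGL d, ∀ p, L.count (diag σ p) = L.count p) (f : V d × V d → Bool) :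
    L.countP (fun p => f p) = L.count (0, 0) * dg f + offRef L * od f := by
  rw [countP_eq_sum_count, Fintype.sum_prod_type]
  have hrow : ∀ x : V d, (∑ y : V d, if f (x, y) = true then L.count (x, y) else 0) =
      (if f (x, x) = true then L.count (0, 0) else 0) +
        offRef L * ((univ.erase x).filter fun y : V d => f (x, y) = true).card := by
    intro x
    rw [← add_sum_erase univ _ (mem_univ x), count_eq_of_diag L hinv x 0]
    congr 1
    rw [card_eq_sum_ones, mul_sum, mul_one, sum_filter]
    refine sum_congr rfl fun y hy => ?_
    have hxy : x ≠ y := (ne_of_mem_erase hy).symm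
    by_cases hf : f (x, y) = true
    · rw [if_pos hf, if_pos hf, count_offDiag_eq_offRef L hinv hxy]
    · rw [if_neg hf, if_neg hf]
  calc (∑ x : V d, ∑ y : V d, if f (x, y) = true then L.count (x, y) else 0)
      = ∑ x : V d, ((if f (x, x) = true then L.count (0, 0) else 0) +
          offRef L * ((univ.erase x).filter fun y : V d => f (x, y) = true).card) :=
        sum_congr rfl fun x _ => hrow x
    _ = L.count (0, 0) * dg f + offRef L * od f := by
        rw [sum_add_distrib, ← mul_sum]
        congr 1
        rw [dg, card_eq_sum_ones, mul_sum, mul_one, sum_filter]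

/-- Two matrices with the same numbers of diagonal and of off-diagonal ones are counted alike by
every `AGL_d`-invariant list of positions. -/
theorem countP_inputs_eq (L : List (V d × V d))
    (hinv : ∀ σ ∈ AGL d, ∀ p, L.count (diag σ p) = L.count p) (A B : V d × V d → Bool)
    (hdg : dg A = dg B) (hod : od A = od B) :
    L.countP (fun p => A p) = L.countP (fun p => B p) := by
  rw [countP_eq_lin L hinv A, countP_eq_lin L hinv B, hdg, hod]

end Summit.ValiantsHypothesis.ValiantsHypothesis.Theorems.SymmetryDialAffineOrbits
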